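import Summits.ValiantsHypothesis.ValiantsHypothesis.Theorems.LacunarySymmetroidMatrixDescartesCensusDoorA34StrataSubStrata
import Summits.ValiantsHypothesis.ValiantsHypothesis.Theorems.LacunarySymmetroidMatrixDescartesCensusMirror

/-!
# `MatrixDescartes` census — DOOR A at `(3,4)`: the BOTTOM sub-strata `tr(adj S₀ · S₁) = 0` (mirror of …StrataSubStrata)

HONEST FRAMING.  Object-search cell `pub-symmetroid`, door-A seat `val-sym-door-p3` (g11); helper rows for the registered strata line on
stmt-ValiantsHypothesis-19980 (`DoorA34 = PosRootLawAt 3 4 18`: OPEN, typed, never asserted).  The companion file closes the sub-strata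
`{det S₃ = 0, tr(adj S₃·S₂) = 0}` (`≤ 17`) and `{det S₀ = det S₃ = 0, tr(adj S₃·S₂) = 0}` (`≤ 16`) by monomial count.  By the MIRROR
`x ↦ x⁻¹` of the census table (`Census.card_posRoots_det_pencil_mirror`, `Census.pencil_comp_equiv` with the reversal of the four letters)
the same holds with the roles of the two ends exchanged:

* `posRoots_le_17_of_nullBottom_of_trace_adjugate_eq_zero` — `det S₀ = 0 ∧ tr(adj S₀ · S₁) = 0 ⇒ ≤ 17` (any `d`, any real letters);
* `posRoots_le_16_of_nullNull_of_trace_adjugate_bottom_eq_zero` — `StrictMono d`, `det S₀ = det S₃ = 0`, `tr(adj S₀ · S₁) = 0 ⇒ ≤ 16`.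

So on the null-null stratum the OPEN part of `stub_nullNullCeiling` is the sheet `tr(adj S₀·S₁) ≠ 0 ∧ tr(adj S₃·S₂) ≠ 0` (both end
kernels non-isotropic for the neighbouring letter).  Nothing here bounds `ζ_sym(3,4)`; nothing on `MatrixDescartes` (stmt-18050) / `VP ≠ VNP`.
[folklore] Elementary.
-/

-- `Summit.ValiantsHypothesis.ValiantsHypothesis.…` repeats a component by the D-0017 layout
-- (single-conjunct summit), which the `dupNamespace` linter flags; the name is mandated.
set_option linter.dupNamespace false

namespace Summit.ValiantsHypothesis.ValiantsHypothesis.Theorems.LacunarySymmetroidMatrixDescartes.Census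

open Polynomial Finset
open scoped BigOperators Polynomial Matrix

/-- **Mirror-reversal of a `(3,4)` pencil preserves the positive-root count**: with `N ≥ max d`, the pencil with exponents
`N − d (rev l)` and letters `S (rev l)` has the same number of distinct positive determinant roots. [folklore] -/
theorem card_posRoots_det_pencil_mirror_rev (d : Fin 4 → ℕ) (N : ℕ) (hd : ∀ l, d l ≤ N) (S : Fin 4 → Matrix (Fin 3) (Fin 3) ℝ) :
    ((∑ l, (X : ℝ[X]) ^ (N - d (Fin.rev l)) • (S (Fin.rev l)).map C).det.roots.toFinset.filter (fun t => 0 < t)).card =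
      ((∑ l, (X : ℝ[X]) ^ d l • (S l).map C).det.roots.toFinset.filter (fun t => 0 < t)).card := by
  have h := pencil_comp_equiv (m := 3) Fin.revPerm (fun l => N - d l) S
  simp only [Fin.revPerm_apply] at h
  rw [h]
  exact card_posRoots_det_pencil_mirror d N hd S

/-- **`stub_nullTopCeiling`'s mirror: the BOTTOM sub-stratum `det S₀ = 0 ∧ tr(adj S₀ · S₁) = 0 ⇒ ≤ 17`** (any `d`, any real letters). [folklore] -/
theorem posRoots_le_17_of_nullBottom_of_trace_adjugate_eq_zero (d : Fin 4 → ℕ) (S : Fin 4 → Matrix (Fin 3) (Fin 3) ℝ)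
    (h0 : (S 0).det = 0) (htr : ((S 0).adjugate * S 1).trace = 0) :
    ((Matrix.det (∑ l, ((X : ℝ[X]) ^ d l) • (S l).map C)).roots.toFinset.filter (fun t => 0 < t)).card ≤ 17 := by
  set N := d 0 + d 1 + d 2 + d 3 with hN
  have hd : ∀ l, d l ≤ N := by intro l; fin_cases l <;> simp [hN] <;> omega
  rw [← card_posRoots_det_pencil_mirror_rev d N hd S]
  have h3 : ((fun l : Fin 4 => S (Fin.rev l)) 3).det = 0 := by simpa using h0
  have htr' : (((fun l : Fin 4 => S (Fin.rev l)) 3).adjugate * (fun l : Fin 4 => S (Fin.rev l)) 2).trace = 0 := by simpa using htr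
  exact posRoots_le_17_of_nullTop_of_trace_adjugate_eq_zero (fun l => N - d (Fin.rev l)) (fun l => S (Fin.rev l)) h3 htr'

/-- **`stub_nullNullCeiling` on the BOTTOM sub-stratum**: `StrictMono d`, `det S₀ = det S₃ = 0`, `tr(adj S₀ · S₁) = 0 ⇒ ≤ 16`
distinct positive roots. [folklore] -/
theorem posRoots_le_16_of_nullNull_of_trace_adjugate_bottom_eq_zero (d : Fin 4 → ℕ) (S : Fin 4 → Matrix (Fin 3) (Fin 3) ℝ)
    (hd : StrictMono d) (h0 : (S 0).det = 0) (h3 : (S 3).det = 0) (htr : ((S 0).adjugate * S 1).trace = 0) :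
    ((Matrix.det (∑ l, ((X : ℝ[X]) ^ d l) • (S l).map C)).roots.toFinset.filter (fun t => 0 < t)).card ≤ 16 := by
  have h01 : d 0 < d 1 := hd (by decide)
  have h12 : d 1 < d 2 := hd (by decide)
  have h23 : d 2 < d 3 := hd (by decide)
  have hdN : ∀ l, d l ≤ d 3 := by intro l; fin_cases l <;> simp <;> omega
  rw [← card_posRoots_det_pencil_mirror_rev d (d 3) hdN S]
  have hmono : StrictMono (fun l : Fin 4 => d 3 - d (Fin.rev l)) := by
    refine Fin.strictMono_iff_lt_succ.2 fun j => ?_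
    fin_cases j <;> simp <;> omega
  have h3' : ((fun l : Fin 4 => S (Fin.rev l)) 3).det = 0 := by simpa using h0
  have h0' : ((fun l : Fin 4 => S (Fin.rev l)) 0).det = 0 := by simpa using h3
  have htr' : (((fun l : Fin 4 => S (Fin.rev l)) 3).adjugate * (fun l : Fin 4 => S (Fin.rev l)) 2).trace = 0 := by simpa using htr
  exact posRoots_le_16_of_nullNull_of_trace_adjugate_eq_zero' (fun l => d 3 - d (Fin.rev l)) (fun l => S (Fin.rev l))
    hmono h0' h3' htr'

end Summit.ValiantsHypothesis.ValiantsHypothesis.Theorems.LacunarySymmetroidMatrixDescartes.Census
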